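import Summits.RiemannHypothesis.RiemannHypothesis.Theorems.HandoffEdgeDusart
import Summits.RiemannHypothesis.RiemannHypothesis.Theorems.HandoffEdgeOdd
import Summits.RiemannHypothesis.RiemannHypothesis.Theorems.HandoffCramerBump
import HarnessLib

/-!
# HANDOFF, edge block: the ODD half forces Cramér-order prime gaps; RH ⇒ Cramér through Weil positivity (rh-explicit, track «HANDOFF», seat prove-2 gen2, ATTEMPT-7 §4–§5)

HONEST FRAMING. Nothing here bears on the truth of RH. This file completes the classification of the edge block of the
Schur route (ATTEMPT-4 → 6 → 7): the EVEN half is a theorem for every large `q` given only a gap-RATIO bound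
(`HandoffEdgeDusart.lean`), and the ODD half is — in both directions — a statement about prime gaps of Cramér order:

* `sum_Ioo_vonMangoldt_le_three`, `handoffCrossConstEven_le_of_large` — WITHOUT any gap hypothesis (Bertrand + Chebyshev),
  the even cross constant is `≤ 6.1` on every window with `q ≥ 10⁷` (PROVED).
* `gap_le_of_edgeNonnegOdd` — **`EdgeNonnegOdd q q′ η → q′ − q ≤ cramerGapConst·√q·log q`** for `q ≥ 10⁷`, `0 < η ≤ 1/(4q)`
  (PROVED): otherwise the Cramér bump filling the window (`HandoffCramerBump.lean`: energy `≤ (log(1/r) + C)‖f‖²`, polar mass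
  `|f̂(1)|² ≥ √q·r²`) is a witness for `not_edgeNonnegOdd_of_witness` (`HandoffEdgeOdd.lean`). So an RH-free proof of the odd
  edge block for all `q` would be an RH-free Cramér-order prime-gap theorem (beyond Baker–Harman–Pintz); idea-3's X15 and
  ATTEMPT-4's (GAP-q) are the converse direction.
* `exists_gap_le_sqrt_mul_log_of_riemannHypothesis` — **RH ⇒ ∃ C, ∀ consecutive primes q < q′: q′ − q ≤ C·√q·log q** (PROVED):
  Cramér's 1920 conditional theorem, here obtained as RH ⇒ `H(q)` ⇒ Weil positivity on the window ⇒ `EdgeNonnegOdd` ⇒ the bound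
  (Bertrand absorbs `q < 10⁷`). The constant is not numerically pinned (it carries `‖φ₀‖₂²` and a log-moment of Mathlib's
  unspecified bump); Carneiro–Milinovich–Soundararajan 2019 prove `22/25` with optimal kernels.
-/

set_option linter.dupNamespace false

noncomputable section

open Complex Filter Set MeasureTheory Literature.NumberTheory.LFunctions
  Literature.NumberTheory.LFunctions.WeilContinuous Literature.NumberTheory.LFunctions.TwoBump
open scoped Real Topology ComplexConjugate ContDiff

namespace Summit.RiemannHypothesis.RiemannHypothesis.Theorems.Handoff

variable {q q' : ℕ}

/-! ## §5 The Cramér bound from the odd edge block (ATTEMPT-7 §4–§5) -/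

/-- **Prime powers inside a prime gap, Bertrand version** (no gap hypothesis): for consecutive primes `q < q′` with
`q ≥ 10⁷`, `Σ_{q<n<q′} Λ(n) ≤ 3·√q` (Chebyshev at `√q′ ≥ e⁸` and `q′^{1/3} ≥ e⁴`, with `q′ ≤ 2q`). [folklore] -/
theorem sum_Ioo_vonMangoldt_le_three (hcons : ConsecutivePrimes q q') (hq : (10 : ℝ) ^ 7 ≤ q) :
    ∑ n ∈ Finset.Ioo q q', (ArithmeticFunction.vonMangoldt n : ℝ) ≤ 3 * Real.sqrt q := by
  have hq0 : (0 : ℝ) < q := by exact_mod_cast hcons.1.pos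
  have hqq' : (q : ℝ) ≤ q' := by exact_mod_cast hcons.2.2.1.le
  have hq'0 : (0 : ℝ) < q' := hq0.trans_le hqq'
  have h2q : (q' : ℝ) ≤ 2 * q := by exact_mod_cast hcons.le_two_mul
  have h16 : Real.exp 16 ≤ q := exp_sixteen_le.trans hq
  have h16' : Real.exp 16 ≤ q' := h16.trans hqq'
  have hq'1 : (1 : ℝ) ≤ q' := (Real.one_le_exp (by norm_num : (0:ℝ) ≤ 16)).trans h16'
  have hsqrt : Real.exp 8 ≤ Real.sqrt q' := by
    have e2 : Real.sqrt (Real.exp 16) = Real.exp 8 := by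
      rw [show (16 : ℝ) = 8 + 8 by norm_num, Real.exp_add, Real.sqrt_mul_self (Real.exp_pos 8).le]
    rw [← e2]
    exact Real.sqrt_le_sqrt h16'
  have hcbrt : Real.exp 4 ≤ (q' : ℝ) ^ ((3 : ℝ)⁻¹) := by
    have h12 : Real.exp 12 ≤ q' := (Real.exp_le_exp.2 (by norm_num : (12:ℝ) ≤ 16)).trans h16'
    have e : Real.exp 12 ^ ((3 : ℝ)⁻¹) = Real.exp 4 := by
      rw [← Real.exp_mul]; norm_num
    rw [← e]
    exact Real.rpow_le_rpow (Real.exp_pos 12).le h12 (by norm_num)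
  have h1 := sum_Ioo_vonMangoldt_le_psi_sub_theta hcons
  have h2 := psi_sub_theta_le_sqrt_add_two_cbrt hq'1
  have h3 := psi_le_of_exp_eight_le hsqrt
  have h4 := psi_le_of_exp_four_le hcbrt
  -- √q′ ≤ 1.4143 √q
  have hs : Real.sqrt q' ≤ 1.4143 * Real.sqrt q := by
    have hb : (q' : ℝ) ≤ (1.4143 * Real.sqrt q) ^ 2 := by
      have := Real.sq_sqrt hq0.le
      nlinarith [this]
    exact Real.sqrt_le_iff.2 ⟨by positivity, hb⟩
  have hsplit : (q' : ℝ) ^ ((3 : ℝ)⁻¹) = Real.sqrt q' * (q' : ℝ) ^ (-(6 : ℝ)⁻¹) := by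
    rw [Real.sqrt_eq_rpow, ← Real.rpow_add hq'0]
    norm_num
  have hsmall : (q' : ℝ) ^ (-(6 : ℝ)⁻¹) ≤ 0.0834 := by
    have ha : (q' : ℝ) ^ (-(6 : ℝ)⁻¹) ≤ Real.exp 16 ^ (-(6 : ℝ)⁻¹) :=
      Real.rpow_le_rpow_of_nonpos (Real.exp_pos 16) h16' (by norm_num)
    have hb : Real.exp 16 ^ (-(6 : ℝ)⁻¹) = Real.exp (-(8 / 3)) := by
      rw [← Real.exp_mul]; norm_num
    have hc : Real.exp (-(8 / 3 : ℝ)) ≤ Real.exp (-(5 / 2)) := Real.exp_le_exp.2 (by norm_num)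
    have hd : Real.exp (-(5 / 2 : ℝ)) ≤ 0.0834 := by
      rw [Real.exp_neg, inv_le_comm₀ (Real.exp_pos _) (by norm_num)]
      linarith [exp_five_half_ge]
    linarith [ha, hb.le, hb.ge, hc, hd]
  have hcb : (q' : ℝ) ^ ((3 : ℝ)⁻¹) ≤ 0.0834 * Real.sqrt q' := by
    rw [hsplit, mul_comm (0.0834 : ℝ)]
    exact mul_le_mul_of_nonneg_left hsmall (Real.sqrt_nonneg _)
  have hsq0 : 0 ≤ Real.sqrt q := Real.sqrt_nonneg _
  have hsq'0 : 0 ≤ Real.sqrt q' := Real.sqrt_nonneg _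
  nlinarith [h1, h2, h3, h4, hs, hcb, hsq0, hsq'0]

/-- **The even cross constant is bounded WITHOUT any gap hypothesis**: for consecutive primes `q < q′` with `q ≥ 10⁷` and
`η ≤ 1/(4q)`, `X_ev(b) ≤ 6.1` on the whole window (Bertrand + Chebyshev). [this track, ATTEMPT-7 §5] -/
theorem handoffCrossConstEven_le_of_large (hcons : ConsecutivePrimes q q') (hq : (10 : ℝ) ^ 7 ≤ q) {η b : ℝ}
    (hη : 0 < η) (hηq : η ≤ 1 / (4 * q)) (hb : b ∈ Icc (Real.log q / 2) (Real.log q' / 2)) :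
    handoffCrossConstEven q η b ≤ 6.1 := by
  have hq0 : (0 : ℝ) < q := by exact_mod_cast hcons.1.pos
  have hqq' : (q : ℝ) ≤ q' := by exact_mod_cast hcons.2.2.1.le
  have hq'0 : (0 : ℝ) < q' := hq0.trans_le hqq'
  have h16 : Real.exp 16 ≤ q := exp_sixteen_le.trans hq
  have h16' : Real.exp 16 ≤ q' := h16.trans hqq'
  have hlog16 : (16 : ℝ) ≤ Real.log q := by
    rw [Real.le_log_iff_exp_le hq0]; exact h16
  have hT := sum_Ioo_vonMangoldt_le_three hcons hq
  have hcapq : Real.log q / Real.sqrt q ≤ 0.0054 := log_div_sqrt_le_of_exp_sixteen_le h16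
  have hcapq' : Real.log q' / Real.sqrt q' ≤ 0.0054 := log_div_sqrt_le_of_exp_sixteen_le h16'
  have hG := gapAtomSum_window_le hcons hηq hb
  have hsq : 0 < Real.sqrt q := Real.sqrt_pos.2 hq0
  have hTdiv : (∑ n ∈ Finset.Ioo q q', (ArithmeticFunction.vonMangoldt n : ℝ)) / Real.sqrt q ≤ 3 := by
    rw [div_le_iff₀ hsq]; linarith [hT]
  have hGap : gapAtomSum (Real.log q / 2 - η) b ≤ 3.0108 := by linarith [hG, hcapq, hcapq', hTdiv]
  set c' := Real.log q / 2 - η with hc'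
  have hηsmall : η ≤ 0.001 := by
    have : (1 : ℝ) / (4 * q) ≤ 0.001 := by
      rw [div_le_iff₀ (by positivity)]; linarith
    exact hηq.trans this
  have hc'7 : 7 ≤ c' := by rw [hc']; linarith
  have hM : archGapBound c' ≤ 0.002 := by
    unfold archGapBound
    have he : (1000 : ℝ) ≤ Real.exp c' := exp_seven_ge.trans (Real.exp_le_exp.2 hc'7)
    have hx : Real.exp (-(4 * c')) ≤ 1 / 2 := by
      have h1 : Real.exp (-(4 * c')) ≤ Real.exp (-1) := Real.exp_le_exp.2 (by linarith)
      have h2 := Real.exp_neg_one_lt_d9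
      linarith
    have hden : (500 : ℝ) ≤ Real.exp c' * (1 - Real.exp (-(4 * c'))) := by nlinarith [he, hx, Real.exp_pos c']
    rw [div_le_iff₀ (by linarith)]
    nlinarith [hden]
  have hD0 : 0 ≤ b - c' := by rw [hc']; linarith [hb.1]
  have hDle : b - c' ≤ 1 := by
    have h2q : (q' : ℝ) ≤ 2 * q := by exact_mod_cast hcons.le_two_mul
    have := Real.log_le_log hq'0 h2q
    rw [Real.log_mul (by norm_num) hq0.ne'] at this
    have hl2 := Real.log_two_lt_d9
    rw [hc']; linarith [hb.2]
  have hM0 : 0 ≤ archGapBound c' := (archGapBound_pos (by linarith)).le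
  have hprod : archGapBound c' * (b - c') ≤ 0.002 * 1 := mul_le_mul hM hDle hD0 (by norm_num)
  unfold handoffCrossConstEven
  rw [← hc']
  linarith [hprod, hGap]

/-- The Cramér constant delivered by the Weil-positivity witness: `8e‖φ₀‖₂²·(1/2 + (cramerEnergyConst + 6.1)/16)`
(`φ₀` = Mathlib's bump, so the value is not numerically pinned; CMS 2019 reach `22/25` with optimal kernels). [this track, ATTEMPT-7 §3] -/
def cramerGapConst : ℝ :=
  8 * Real.exp 1 * weilNorm2Sq (moll 0) * (1 / 2 + (cramerEnergyConst + 6.1) / 16)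

/-- `cramerEnergyConst ≥ 0`. [folklore] -/
theorem cramerEnergyConst_nonneg : 0 ≤ cramerEnergyConst := by
  unfold cramerEnergyConst
  have h1 := mollLogMoment_nonneg
  have h2 := Real.exp_pos 1
  have h3 : 0 ≤ mollLogMoment / π := div_nonneg h1 Real.pi_pos.le
  linarith

/-- `cramerGapConst ≥ 1`. [folklore] -/
theorem one_le_cramerGapConst : 1 ≤ cramerGapConst := by
  unfold cramerGapConst
  have hφ := half_le_weilNorm2Sq_moll_zero
  have hE := cramerEnergyConst_nonneg
  have he : (2.7 : ℝ) ≤ Real.exp 1 := by linarith [Real.exp_one_gt_d9]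
  have h1 : (1 : ℝ) / 2 ≤ 1 / 2 + (cramerEnergyConst + 6.1) / 16 := by linarith [div_nonneg (by linarith : 0 ≤ cramerEnergyConst + 6.1) (by norm_num : (0:ℝ) ≤ 16)]
  have hφ0 : 0 ≤ weilNorm2Sq (moll 0) := by linarith
  have he0 : 0 ≤ Real.exp 1 := (Real.exp_pos 1).le
  have hP : 0 ≤ 8 * Real.exp 1 * weilNorm2Sq (moll 0) := by positivity
  nlinarith [mul_le_mul he hφ (by norm_num) he0, mul_nonneg hP (by linarith : (0:ℝ) ≤ 1 / 2 + (cramerEnergyConst + 6.1) / 16 - 1/2)]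

/-- **The odd edge block forces a Cramér-order gap.** For consecutive primes `q < q′` with `q ≥ 10⁷` and an overlap
`0 < η ≤ 1/(4q)`: `EdgeNonnegOdd q q′ η → q′ − q ≤ cramerGapConst·√q·log q`. Proof: otherwise the Cramér bump of radius
`r = ¼log(q′/q) ≥ (q′−q)/(8q)` filling the window is a witness for `not_edgeNonnegOdd_of_witness`: its energy is
`≤ (log(1/r) + cramerEnergyConst)·‖f‖²` (`re_weilQuadratic_cramerBump_le`), the even cross constant is `≤ 6.1`
(`handoffCrossConstEven_le_of_large`), while its polar mass is `|f̂(1)|² ≥ √q·r²` (`normSq_weilMellin_cramerBump_one_ge`).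
An RH-free proof of `EdgeNonnegOdd` for all `q` would thus be an RH-free Cramér-order prime-gap theorem (ATTEMPT-7 §4).
[this track, ATTEMPT-7 §2–§5] -/
theorem gap_le_of_edgeNonnegOdd (hcons : ConsecutivePrimes q q') (hq : (10 : ℝ) ^ 7 ≤ q) {η : ℝ} (hη : 0 < η)
    (hηq : η ≤ 1 / (4 * q)) (hE : EdgeNonnegOdd q q' η) :
    (q' : ℝ) - q ≤ cramerGapConst * Real.sqrt q * Real.log q := by
  by_contra hgap
  rw [not_le] at hgap
  have hq0 : (0 : ℝ) < q := by exact_mod_cast hcons.1.pos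
  have hqq' : (q : ℝ) < q' := by exact_mod_cast hcons.2.2.1
  have hq'0 : (0 : ℝ) < q' := hq0.trans hqq'
  have h2q : (q' : ℝ) ≤ 2 * q := by exact_mod_cast hcons.le_two_mul
  have h16 : Real.exp 16 ≤ q := exp_sixteen_le.trans hq
  have hlog16 : (16 : ℝ) ≤ Real.log q := by
    rw [Real.le_log_iff_exp_le hq0]; exact h16
  have hsq : 0 < Real.sqrt q := Real.sqrt_pos.2 hq0
  have hsq16 : Real.exp 8 ≤ Real.sqrt q := by
    have e2 : Real.sqrt (Real.exp 16) = Real.exp 8 := by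
      rw [show (16 : ℝ) = 8 + 8 by norm_num, Real.exp_add, Real.sqrt_mul_self (Real.exp_pos 8).le]
    rw [← e2]; exact Real.sqrt_le_sqrt h16
  have hsq1 : 1 ≤ Real.sqrt q := le_trans (Real.one_le_exp (by norm_num)) hsq16
  -- the window and the bump
  set δ₀ : ℝ := Real.log q' / 2 - Real.log q / 2 with hδ₀
  have hδq : δ₀ = Real.log ((q' : ℝ) / q) / 2 := by
    rw [hδ₀, Real.log_div hq'0.ne' hq0.ne']; ring
  have hδpos : 0 < δ₀ := by
    rw [hδ₀]; linarith [Real.log_lt_log hq0 hqq']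
  have hδle : δ₀ ≤ Real.log 2 / 2 := by
    have := Real.log_le_log hq'0 h2q
    rw [Real.log_mul (by norm_num) hq0.ne'] at this
    rw [hδ₀]; linarith
  -- lower bound: δ₀ ≥ (q′ − q)/(4q)
  have hδge : ((q' : ℝ) - q) / (4 * q) ≤ δ₀ := by
    rw [hδq]
    have h1 := Real.one_sub_inv_le_log_of_pos (div_pos hq'0 hq0)
    rw [inv_div] at h1
    have h2 : ((q' : ℝ) - q) / (2 * q) ≤ 1 - q / q' := by
      rw [div_le_iff₀ (by positivity)]
      have : (1 - (q : ℝ) / q') * (2 * q) = 2 * q * ((q' : ℝ) - q) / q' := by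
        field_simp
      rw [this, le_div_iff₀ hq'0]
      nlinarith
    have : ((q' : ℝ) - q) / (4 * q) = (((q' : ℝ) - q) / (2 * q)) / 2 := by
      field_simp
      ring
    rw [this]; linarith
  set r : ℝ := δ₀ / 2 with hr_def
  have hr : 0 < r := by rw [hr_def]; positivity
  have hl2 := Real.log_two_lt_d9
  have hr4 : r ≤ 1 / 4 := by rw [hr_def]; linarith
  have hr1 : r ≤ 1 := by linarith
  set x₀ : ℝ := Real.log q / 2 + r with hx₀
  set b : ℝ := Real.log q' / 2 with hb_def
  have hb : b ∈ Icc (Real.log q / 2) (Real.log q' / 2) := ⟨by rw [hb_def]; linarith, le_rfl⟩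
  set f := cramerBump r x₀ with hf_def
  have hf : IsWeilTest f := isWeilTest_cramerBump hr x₀
  have hfs : tsupport f ⊆ Icc (Real.log q / 2) b := by
    refine (tsupport_cramerBump_subset hr x₀).trans (Icc_subset_Icc (by rw [hx₀]; linarith) ?_)
    rw [hx₀, hb_def, hr_def, hδ₀]; linarith
  have hη' : η < Real.log q / 2 := by
    have : (1 : ℝ) / (4 * q) ≤ 1 := by rw [div_le_iff₀ (by positivity)]; linarith
    linarith [hηq.trans this]
  -- the three estimates
  have hE_le := re_weilQuadratic_cramerBump_le hr hr4 x₀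
  have hP_ge := normSq_weilMellin_cramerBump_one_ge hr hr1 x₀
  have hX := handoffCrossConstEven_le_of_large hcons hq hη hηq hb
  have hN : ∫ x : ℝ, ‖f x‖ ^ 2 = r * weilNorm2Sq (moll 0) := integral_norm_sq_cramerBump hr x₀
  set Φ := weilNorm2Sq (moll 0) with hΦ
  have hΦ0 : 1 / 2 ≤ Φ := half_le_weilNorm2Sq_moll_zero
  have hC0 := cramerEnergyConst_nonneg
  -- e^{x₀ − 1} ≥ √q / e
  have hexp : Real.sqrt q * Real.exp (-1) ≤ Real.exp (x₀ - 1) := by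
    have e1 : Real.exp (x₀ - 1) = Real.exp (Real.log q / 2) * Real.exp r * Real.exp (-1) := by
      rw [hx₀, ← Real.exp_add, ← Real.exp_add]
      exact congrArg Real.exp (by ring)
    have e2 : Real.exp (Real.log q / 2) = Real.sqrt q := by
      rw [show Real.log q / 2 = Real.log q * (1 / 2) by ring, Real.exp_mul, Real.exp_log hq0, Real.sqrt_eq_rpow]
    rw [e1, e2]
    have h1 : 1 ≤ Real.exp r := Real.one_le_exp hr.le
    have : Real.sqrt q * Real.exp (-1) * 1 ≤ Real.sqrt q * Real.exp (-1) * Real.exp r :=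
      mul_le_mul_of_nonneg_left h1 (by positivity)
    linarith
  -- log(1/r) ≤ (log q)/2 : r ≥ g/(8q) > C log q /(8 √q) ≥ log q/(8√q) ≥ 1/√q·2 ...
  have hC1 := one_le_cramerGapConst
  have hCpos : 0 < cramerGapConst := lt_of_lt_of_le one_pos hC1
  have hClog : 0 < cramerGapConst * Real.log q := mul_pos hCpos (by linarith)
  have hr_ge : cramerGapConst * Real.log q / (8 * Real.sqrt q) < r := by
    have h1 : ((q' : ℝ) - q) / (8 * q) ≤ r := by
      rw [hr_def]
      have : ((q' : ℝ) - q) / (8 * q) = (((q' : ℝ) - q) / (4 * q)) / 2 := by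
        field_simp
        ring
      rw [this]; linarith
    have h2 : cramerGapConst * Real.log q / (8 * Real.sqrt q) = (cramerGapConst * Real.sqrt q * Real.log q) / (8 * q) := by
      have hq' : (q : ℝ) = Real.sqrt q * Real.sqrt q := (Real.mul_self_sqrt hq0.le).symm
      rw [div_eq_div_iff (by positivity) (by positivity)]
      nth_rewrite 2 [hq']
      ring
    rw [h2]
    exact lt_of_lt_of_le (div_lt_div_of_pos_right hgap (by positivity)) h1
  have hlogr : Real.log (1 / r) ≤ Real.log q / 2 := by
    -- 1/r < 8√q/(C log q) ≤ √q  (C log q ≥ 16 ≥ 8)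
    have hA : 1 / r < 8 * Real.sqrt q / (cramerGapConst * Real.log q) := by
      rw [div_lt_div_iff₀ hr hClog]
      have := (div_lt_iff₀ (by positivity : (0:ℝ) < 8 * Real.sqrt q)).1 hr_ge
      linarith
    have hB : 8 * Real.sqrt q / (cramerGapConst * Real.log q) ≤ Real.sqrt q := by
      rw [div_le_iff₀ hClog]
      have hCl : 16 ≤ cramerGapConst * Real.log q := by
        have := mul_le_mul hC1 hlog16 (by norm_num) hCpos.le
        linarith
      have := mul_le_mul_of_nonneg_left hCl hsq.le
      linarith
    have h1 : 1 / r ≤ Real.sqrt q := (hA.trans_le hB).le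
    have h2 := Real.log_le_log (by positivity) h1
    rwa [Real.log_sqrt hq0.le] at h2
  -- the witness inequality
  have hneg : (weilQuadratic f).re + handoffCrossConstEven q η b * ∫ u : ℝ, ‖f u‖ ^ 2 <
      Complex.normSq (weilMellin f 0) + Complex.normSq (weilMellin f 1) := by
    rw [hN]
    rw [hN] at hE_le
    have h0 : 0 ≤ Complex.normSq (weilMellin f 0) := Complex.normSq_nonneg _
    have hΦpos : 0 < Φ := by linarith
    have hrΦ : 0 ≤ r * Φ := mul_nonneg hr.le hΦpos.le
    -- LHS ≤ (log q/2 + C_E + 6.1)·(rΦ)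
    have hX' := mul_le_mul_of_nonneg_right hX hrΦ
    have hlog' := mul_le_mul_of_nonneg_right hlogr hrΦ
    have hL : (weilQuadratic f).re + handoffCrossConstEven q η b * (r * Φ) ≤
        (Real.log q / 2 + cramerEnergyConst + 6.1) * (r * Φ) := by
      have e1 : (Real.log (1 / r) + cramerEnergyConst) * (r * Φ) =
          Real.log (1 / r) * (r * Φ) + cramerEnergyConst * (r * Φ) := by ring
      have e2 : (Real.log q / 2 + cramerEnergyConst + 6.1) * (r * Φ) =
          Real.log q / 2 * (r * Φ) + cramerEnergyConst * (r * Φ) + 6.1 * (r * Φ) := by ring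
      rw [e2]
      rw [e1] at hE_le
      linarith only [hE_le, hX', hlog']
    -- RHS ≥ √q e^{-1} r²
    have hR : Real.sqrt q * Real.exp (-1) * r ^ 2 ≤ Complex.normSq (weilMellin f 1) :=
      le_trans (mul_le_mul_of_nonneg_right hexp (sq_nonneg r)) hP_ge
    -- key: (log q/2 + C_E + 6.1)·Φ < √q e^{-1} r
    set A : ℝ := 1 / 2 + (cramerEnergyConst + 6.1) / 16 with hA_def
    have hCdef : cramerGapConst = 8 * Real.exp 1 * Φ * A := by
      rw [cramerGapConst, hΦ, hA_def]
    have hkey : (Real.log q / 2 + cramerEnergyConst + 6.1) * Φ < Real.sqrt q * Real.exp (-1) * r := by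
      have h1 : Real.sqrt q * Real.exp (-1) * (cramerGapConst * Real.log q / (8 * Real.sqrt q)) <
          Real.sqrt q * Real.exp (-1) * r := mul_lt_mul_of_pos_left hr_ge (by positivity)
      refine lt_of_le_of_lt ?_ h1
      have e : Real.sqrt q * Real.exp (-1) * (cramerGapConst * Real.log q / (8 * Real.sqrt q)) =
          Φ * A * Real.log q := by
        rw [hCdef, Real.exp_neg]
        have hsqne : Real.sqrt q ≠ 0 := hsq.ne'
        have hene : Real.exp 1 ≠ 0 := (Real.exp_pos 1).ne'
        field_simp
      rw [e]
      have hE0 : 0 ≤ cramerEnergyConst + 6.1 := by linarith only [hC0]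
      have h2 : cramerEnergyConst + 6.1 ≤ (cramerEnergyConst + 6.1) / 16 * Real.log q := by
        have h16 := mul_le_mul_of_nonneg_left hlog16 (div_nonneg hE0 (by norm_num : (0:ℝ) ≤ 16))
        have e16 : (cramerEnergyConst + 6.1) / 16 * 16 = cramerEnergyConst + 6.1 := by ring
        linarith only [h16, e16]
      have h3 : Real.log q / 2 + cramerEnergyConst + 6.1 ≤ A * Real.log q := by
        have eA : A * Real.log q = Real.log q / 2 + (cramerEnergyConst + 6.1) / 16 * Real.log q := by
          rw [hA_def]; ring
        linarith only [h2, eA]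
      calc (Real.log q / 2 + cramerEnergyConst + 6.1) * Φ ≤ (A * Real.log q) * Φ :=
            mul_le_mul_of_nonneg_right h3 hΦpos.le
        _ = Φ * A * Real.log q := by ring
    have hkey' := mul_lt_mul_of_pos_right hkey hr
    have e3 : (Real.log q / 2 + cramerEnergyConst + 6.1) * (r * Φ) =
        (Real.log q / 2 + cramerEnergyConst + 6.1) * Φ * r := by ring
    have e4 : Real.sqrt q * Real.exp (-1) * r ^ 2 = Real.sqrt q * Real.exp (-1) * r * r := by ring
    rw [e3] at hL
    rw [e4] at hR
    linarith only [hL, hR, hkey', h0]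
  exact not_edgeNonnegOdd_of_witness hη hη' hb hf hfs hneg hE

/-- **RH ⇒ Cramér-order prime gaps, through Weil positivity.** `RiemannHypothesis → ∃ C, ∀ consecutive primes q < q′,
q′ − q ≤ C·√q·log q` — Cramér's 1920 conditional theorem, here obtained from the HANDOFF edge block: RH ⇒ `H(q)` ⇒ Weil positivity
on the window ⇒ `EdgeNonnegOdd q q′ (1/(4q))` ⇒ `gap_le_of_edgeNonnegOdd` (for `q ≥ 10⁷`; Bertrand absorbs `q < 10⁷` into `C`).
The constant is not numerically pinned (it depends on Mathlib's bump); Carneiro–Milinovich–Soundararajan prove `22/25` with optimal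
kernels. Nothing here bears on the truth of RH. [cite: CarneiroMilinovichSoundararajan2019, Thm 5 (RH ⇒ a prime in [x, x + (22/25)√x log x]; Cramér 1920 for O(√x log x))] -/
theorem exists_gap_le_sqrt_mul_log_of_riemannHypothesis (hRH : RiemannHypothesis) :
    ∃ C : ℝ, ∀ q q' : ℕ, ConsecutivePrimes q q' → (q' : ℝ) - q ≤ C * Real.sqrt q * Real.log q := by
  refine ⟨max cramerGapConst (11000000), fun q q' hcons ↦ ?_⟩
  have hq0 : (0 : ℝ) < q := by exact_mod_cast hcons.1.pos
  have hq2 : (2 : ℝ) ≤ q := by exact_mod_cast hcons.1.two_le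
  have hsq : Real.sqrt 2 ≤ Real.sqrt q := Real.sqrt_le_sqrt hq2
  have hs2 : (1.41 : ℝ) ≤ Real.sqrt 2 := by
    rw [Real.le_sqrt (by norm_num) (by norm_num)]; norm_num
  have hlog2 : Real.log 2 ≤ Real.log q := Real.log_le_log (by norm_num) hq2
  have hl2 := Real.log_two_gt_d9
  have hprod : 0.97 ≤ Real.sqrt q * Real.log q := by nlinarith
  rcases le_or_gt ((10 : ℝ) ^ 7) q with hq | hq
  · have hH : HandoffH q q' := (riemannHypothesis_iff_forall_handoffH.1 hRH) q q' hcons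
    have hW : WeilPositivityOn (Real.log q' / 2) := (handoffH_iff_weilPositivityOn hcons).1 hH
    have hEdge : EdgeNonneg q q' (1 / (4 * q)) :=
      fun b hb h hh ↦ hW h hh.1 (hh.2.1.trans (Icc_subset_Icc (neg_le_neg hb.2) hb.2))
    have hOdd : EdgeNonnegOdd q q' (1 / (4 * q)) := ((edgeNonneg_iff_even_and_odd q q' _).1 hEdge).2
    have h := gap_le_of_edgeNonnegOdd hcons hq (by positivity) le_rfl hOdd
    refine h.trans ?_
    have hmax : cramerGapConst ≤ max cramerGapConst 11000000 := le_max_left _ _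
    have hpos : 0 ≤ Real.sqrt q * Real.log q := by linarith
    have := mul_le_mul_of_nonneg_right hmax hpos
    calc cramerGapConst * Real.sqrt q * Real.log q = cramerGapConst * (Real.sqrt q * Real.log q) := by ring
      _ ≤ max cramerGapConst 11000000 * (Real.sqrt q * Real.log q) := this
      _ = _ := by ring
  · have hgap : (q' : ℝ) - q ≤ q := by
      have : (q' : ℝ) ≤ 2 * q := by exact_mod_cast hcons.le_two_mul
      linarith
    have hmax : (11000000 : ℝ) ≤ max cramerGapConst 11000000 := le_max_right _ _
    have hpos : 0 ≤ Real.sqrt q * Real.log q := by linarith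
    have := mul_le_mul_of_nonneg_right hmax hpos
    calc (q' : ℝ) - q ≤ q := hgap
      _ ≤ 11000000 * (Real.sqrt q * Real.log q) := by nlinarith [hprod]
      _ ≤ max cramerGapConst 11000000 * (Real.sqrt q * Real.log q) := this
      _ = _ := by ring

end Summit.RiemannHypothesis.RiemannHypothesis.Theorems.Handoff
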